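import Literature.NumberTheory.EllipticCurves.JacobiThetaQuartic
import HarnessLib

/-!
# The modular `λ`-function `λ(τ) = θ₂(τ)⁴ / θ₃(τ)⁴`

Legendre's modulus `k² = λ(τ)` as a function on the upper half-plane: the classical Hauptmodul
of `Γ(2)`, uniformizing `Y(2) = ℍ/Γ(2) ≅ ℙ¹ ∖ {0, 1, ∞}`. It is the variable `x = λ/16` of
Calegari–Dimitrov–Tang's proof of the unbounded denominators conjecture (F. Calegari, V. Dimitrov,
Y. Tang, J. Amer. Math. Soc. **38** (2025), arXiv:2109.09040, §1 p. 3: "`λ(τ)/16 =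
(η(τ/2)η(2τ)²/η(τ)³)⁸ = q ∏ ((1 + q^{2n})/(1 + q^{2n−1}))⁸ = q − 8q² + ⋯`, `q = e^{πiτ}` … The
function `f` is then an algebraic function of `λ`, with branching only at the three punctures
`λ = 0, 1, ∞` of the modular curve `Y(2)`").

We DEFINE `modularLambda τ = theta2 τ ^ 4 / theta3 τ ^ 4` from the thetanulls of
`Literature/NumberTheory/EllipticCurves/JacobiThetaDerivativeFormula.lean` (Mathlib's two-variable
`jacobiTheta₂`; junk value `0` off `ℍ`) and prove:

* `thetaP_ne_zero`, `theta2_ne_zero`, `theta3_ne_zero`, `theta4_ne_zero` — the thetanulls do not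
  vanish on `ℍ`: `P⁸ = (θ₂θ₃θ₄)⁸` is a level-one cusp form of weight `12`, hence `c·Δ`
  (tree: `cuspF₂`, `exists_eq_mul_discriminant`), `Δ ≠ 0` on `ℍ` (Mathlib
  `ModularForm.discriminant_ne_zero`), and `P ≢ 0` (`e^{-πiτ/4} P → 2`);
* `one_sub_modularLambda` — `1 − λ = θ₄⁴/θ₃⁴` (Jacobi's quartic identity, tree
  `theta3_pow_four`); `modularLambda_ne_zero`, `modularLambda_ne_one` on `ℍ`;
* `modularLambda_add_two` (`λ(τ+2) = λ(τ)`), `modularLambda_add_one`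
  (`λ(τ+1) = λ/(λ−1)`), `modularLambda_neg_one_div` (`λ(−1/τ) = 1 − λ(τ)`);
* `differentiableAt_modularLambda` — holomorphy on `ℍ`;
* `modularLambda_I_mul` — on the imaginary axis `λ(iy) ∈ (0, 1)` is the ratio of the real
  thetanulls (tree `theta2_div_theta3_pow_four_mem_Ioo`);
* `tendsto_exp_mul_modularLambda` — `e^{−πiτ} λ(τ) → 16` at `i∞` (`λ/16 = q + O(q²)`), and
  `tendsto_modularLambda` (`λ → 0`);
* `modularLambda_S_smul`, `modularLambda_T_sq_smul` — `λ(S • z) = 1 − λ(z)`, `λ(T² • z) = λ(z)`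
  on `ℍ`; the full `Γ(2)`-modularity `λ|₀γ = λ` (`γ ∈ Γ(2)`) is in the sibling file
  `ModularLambdaGammaTwo.lean` (via the generators `T²`, `S T² S⁻¹`, `−1` of `Γ(2)`).

Not here: the product formula / `η`-quotient expression (no Jacobi triple product in Mathlib),
the covering property `λ : ℍ → ℂ ∖ {0,1}`, and `λ(ℍ) = ℂ ∖ {0, 1}`.

## References

* E. T. Whittaker, G. N. Watson, *A Course of Modern Analysis*, 4th ed. (1927), §21.7, §22.
* [CalegariDimitrovTang2025] arXiv:2109.09040, §1 p. 3 (`λ`, `Y(2)`), §3 Proposition 15.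
-/

noncomputable section

open Complex Real Filter Topology

open scoped Real

namespace Literature.NumberTheory.Automorphic

open Literature.NumberTheory.EllipticCurves.JacobiThetaNull

/-- **The modular `λ`-function** `λ(τ) = θ₂(τ)⁴ / θ₃(τ)⁴` (Legendre's `k²`; the Hauptmodul of
`Γ(2)`), as a function on `ℂ` built from the thetanulls `theta2`, `theta3` of Mathlib's
two-variable theta function; it is `0` off the upper half-plane (junk value).
[cite: CalegariDimitrovTang2025, §1 p. 3] -/
def modularLambda (τ : ℂ) : ℂ := theta2 τ ^ 4 / theta3 τ ^ 4

namespace ModularLambda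

variable {τ : ℂ}

/-- Unfolding lemma. [folklore] -/
theorem modularLambda_def (τ : ℂ) : modularLambda τ = theta2 τ ^ 4 / theta3 τ ^ 4 := rfl

/-! ### Nonvanishing of the thetanulls on `ℍ` -/

/-- **`θ₂θ₃θ₄ ≠ 0` on `ℍ`.** `P⁸` is a level-one cusp form of weight `12` (tree: `cuspF₂`), so
`P⁸ = c·Δ` for a constant `c`; a zero of `P` in `ℍ` forces `c = 0` (`Δ ≠ 0` on `ℍ`), i.e.
`P ≡ 0` on `ℍ`, contradicting `e^{-πiτ/4} P(τ) → 2` at `i∞`. [folklore] -/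
theorem thetaP_ne_zero (hτ : 0 < im τ) : thetaP τ ≠ 0 := by
  obtain ⟨c, hc⟩ := exists_eq_mul_discriminant cuspF₂
  intro h0
  have hc0 : c = 0 := by
    have e := hc ⟨τ, hτ⟩
    have hL : (cuspF₂ ⟨τ, hτ⟩ : ℂ) = thetaP τ ^ 8 := rfl
    rw [hL, h0, zero_pow (by norm_num)] at e
    exact (mul_eq_zero.mp e.symm).resolve_right (ModularForm.discriminant_ne_zero _)
  have hzero : ∀ σ : ℂ, 0 < im σ → thetaP σ = 0 := by
    intro σ hσ
    have e := hc ⟨σ, hσ⟩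
    have hL : (cuspF₂ ⟨σ, hσ⟩ : ℂ) = thetaP σ ^ 8 := rfl
    rw [hL, hc0, zero_mul] at e
    exact (pow_eq_zero_iff (by norm_num)).mp e
  -- but `e^{-πiτ/4} P → 2`
  have h2 : ∀ᶠ σ in comap im atTop, dist (cexp (-(π * I * σ / 4)) * thetaP σ) 2 < 1 :=
    tendsto_thetaP (Metric.ball_mem_nhds 2 one_pos)
  have him : ∀ᶠ σ : ℂ in comap im atTop, 0 < im σ := by
    filter_upwards [preimage_mem_comap (Ioi_mem_atTop (0 : ℝ))] with σ hσ using hσ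
  obtain ⟨σ, hσ, hσ'⟩ := (h2.and him).exists
  rw [hzero σ hσ', mul_zero, dist_comm, dist_eq_norm, sub_zero] at hσ
  norm_num at hσ

/-- `θ₂ ≠ 0` on `ℍ`. [folklore] -/
theorem theta2_ne_zero (hτ : 0 < im τ) : theta2 τ ≠ 0 := fun h ↦
  thetaP_ne_zero hτ (by rw [thetaP, h, zero_mul, zero_mul])

/-- `θ₃ ≠ 0` on `ℍ`. [folklore] -/
theorem theta3_ne_zero (hτ : 0 < im τ) : theta3 τ ≠ 0 := fun h ↦
  thetaP_ne_zero hτ (by rw [thetaP, h, mul_zero, zero_mul])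

/-- `θ₄ ≠ 0` on `ℍ`. [folklore] -/
theorem theta4_ne_zero (hτ : 0 < im τ) : theta4 τ ≠ 0 := fun h ↦
  thetaP_ne_zero hτ (by rw [thetaP, h, mul_zero])

/-! ### `λ`, `1 - λ` and their nonvanishing -/

/-- **`1 − λ(τ) = θ₄(τ)⁴/θ₃(τ)⁴`** on `ℍ` (Jacobi's quartic identity `θ₃⁴ = θ₂⁴ + θ₄⁴`).
[folklore] -/
theorem one_sub_modularLambda (hτ : 0 < im τ) :
    1 - modularLambda τ = theta4 τ ^ 4 / theta3 τ ^ 4 := by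
  have h3 : theta3 τ ^ 4 ≠ 0 := pow_ne_zero 4 (theta3_ne_zero hτ)
  rw [modularLambda, eq_div_iff h3, sub_mul, div_mul_cancel₀ _ h3, one_mul, theta3_pow_four]
  ring

/-- `λ ≠ 0` on `ℍ`. [folklore] -/
theorem modularLambda_ne_zero (hτ : 0 < im τ) : modularLambda τ ≠ 0 :=
  div_ne_zero (pow_ne_zero 4 (theta2_ne_zero hτ)) (pow_ne_zero 4 (theta3_ne_zero hτ))

/-- `λ ≠ 1` on `ℍ`. [folklore] -/
theorem modularLambda_ne_one (hτ : 0 < im τ) : modularLambda τ ≠ 1 := by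
  intro h
  have h1 := one_sub_modularLambda hτ
  rw [h, sub_self] at h1
  exact div_ne_zero (pow_ne_zero 4 (theta4_ne_zero hτ)) (pow_ne_zero 4 (theta3_ne_zero hτ)) h1.symm

/-! ### Transformation laws -/

/-- **`λ(τ + 2) = λ(τ)`** (for every `τ : ℂ`). [folklore] -/
theorem modularLambda_add_two (τ : ℂ) : modularLambda (τ + 2) = modularLambda τ := by
  rw [modularLambda, modularLambda, show τ + 2 = τ + 1 + 1 by ring, theta2_add_one,
    theta2_add_one, theta3_add_one, theta4_add_one, ← mul_assoc, mul_pow, ← pow_two, ← pow_mul,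
    show 2 * 4 = 8 from rfl, exp_pi_I_div_four_pow_eight, one_mul]

/-- **`λ(τ + 1) = λ(τ)/(λ(τ) − 1)`** on `ℍ` (`θ₂(τ+1)⁴ = −θ₂⁴`, `θ₃(τ+1) = θ₄`). [folklore] -/
theorem modularLambda_add_one (hτ : 0 < im τ) :
    modularLambda (τ + 1) = modularLambda τ / (modularLambda τ - 1) := by
  have h3 : theta3 τ ≠ 0 := theta3_ne_zero hτ
  have h4 : theta4 τ ≠ 0 := theta4_ne_zero hτ
  have hsub : modularLambda τ - 1 = -(theta4 τ ^ 4 / theta3 τ ^ 4) := by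
    rw [← one_sub_modularLambda hτ, neg_sub]
  rw [hsub, modularLambda, modularLambda, theta2_add_one, theta3_add_one, mul_pow,
    exp_pi_I_div_four_pow_four]
  field_simp

/-- **`λ(−1/τ) = 1 − λ(τ)`** on `ℍ` (`θ₂(−1/τ)⁴ = −τ²θ₄⁴`, `θ₃(−1/τ)⁴ = −τ²θ₃⁴`). [folklore] -/
theorem modularLambda_neg_one_div (hτ : 0 < im τ) :
    modularLambda (-1 / τ) = 1 - modularLambda τ := by
  have hτ2 : -τ ^ 2 ≠ 0 := neg_ne_zero.mpr (pow_ne_zero 2 (ne_zero_of_im_pos hτ))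
  rw [one_sub_modularLambda hτ, modularLambda, theta2_neg_one_div hτ, theta3_neg_one_div hτ,
    mul_pow, mul_pow, cpow_half_pow_four, mul_div_mul_left _ _ hτ2]

/-! ### Holomorphy -/

/-- `λ` is holomorphic on `ℍ`. [folklore] -/
theorem differentiableAt_modularLambda (hτ : 0 < im τ) : DifferentiableAt ℂ modularLambda τ :=
  ((differentiableAt_theta2 hτ).pow 4).div ((differentiableAt_theta3 hτ).pow 4)
    (pow_ne_zero 4 (theta3_ne_zero hτ))

/-! ### The imaginary axis and the cusp `i∞` -/

/-- On the positive imaginary axis `λ(iy)` is the real number `θ₂(iy)⁴/θ₃(iy)⁴ ∈ (0, 1)`.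
[folklore] -/
theorem modularLambda_I_mul {y : ℝ} (hy : 0 < y) :
    modularLambda (I * y) = (((theta2 (I * y)).re ^ 4 / (theta3 (I * y)).re ^ 4 : ℝ) : ℂ) ∧
      (theta2 (I * y)).re ^ 4 / (theta3 (I * y)).re ^ 4 ∈ Set.Ioo (0 : ℝ) 1 := by
  refine ⟨?_, theta2_div_theta3_pow_four_mem_Ioo hy⟩
  rw [modularLambda, theta2_I_mul_eq_re hy, theta3_I_mul_eq_re hy]
  push_cast
  rfl

/-- **`e^{−πiτ} λ(τ) → 16`** as `Im τ → ∞`, i.e. `λ/16 = q + O(q²)` with `q = e^{πiτ}`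
(`e^{−πiτ/4} θ₂ → 2`, `θ₃ → 1`). [cite: CalegariDimitrovTang2025, §1 p. 3] -/
theorem tendsto_exp_mul_modularLambda :
    Tendsto (fun τ : ℂ ↦ cexp (-(π * I * τ)) * modularLambda τ) (comap im atTop) (𝓝 16) := by
  have h := (tendsto_theta2.pow 4).div (tendsto_theta3.pow 4) (by norm_num)
  rw [show ((2 : ℂ) ^ 4 / 1 ^ 4) = 16 by norm_num] at h
  refine h.congr fun τ ↦ ?_
  simp only [Pi.div_apply]
  rw [mul_pow, ← Complex.exp_nat_mul, modularLambda, mul_div_assoc]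
  congr 2
  push_cast
  ring

/-- `λ(τ) → 0` as `Im τ → ∞`. [folklore] -/
theorem tendsto_modularLambda : Tendsto modularLambda (comap im atTop) (𝓝 0) := by
  have h := (tendsto_theta2_zero.pow 4).div (tendsto_theta3.pow 4) (by norm_num)
  rw [show ((0 : ℂ) ^ 4 / 1 ^ 4) = 0 by norm_num] at h
  exact h.congr fun τ ↦ rfl

/-! ### Behaviour under `S` and `T²` on `ℍ` -/

section Modularity

open UpperHalfPlane ModularGroup CongruenceSubgroup Matrix.SpecialLinearGroup

open scoped MatrixGroups ModularForm

/-- `λ(S • z) = 1 − λ(z)` for `z ∈ ℍ` (`S • z = −1/z`). [folklore] -/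
theorem modularLambda_S_smul (z : ℍ) :
    modularLambda ((ModularGroup.S • z : ℍ) : ℂ) = 1 - modularLambda z := by
  rw [modular_S_smul, coe_mk, inv_neg, inv_eq_one_div, ← neg_div]
  exact modularLambda_neg_one_div z.2

/-- `λ(T² • z) = λ(z)` for `z ∈ ℍ`. [folklore] -/
theorem modularLambda_T_sq_smul (z : ℍ) :
    modularLambda ((ModularGroup.T ^ 2 • z : ℍ) : ℂ) = modularLambda z := by
  rw [show (ModularGroup.T ^ 2 : SL(2, ℤ)) = ModularGroup.T ^ (2 : ℤ) from (zpow_ofNat _ 2).symm,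
    modular_T_zpow_smul, coe_vadd]
  push_cast
  rw [add_comm, modularLambda_add_two]

end Modularity

end ModularLambda

end Literature.NumberTheory.Automorphic

end
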